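import Summits.QuantumFields.BalabanUV.Beta.RemainderExplicitTorusBounds
import Summits.QuantumFields.BalabanUV.Beta.GAN24.TorusAvatar

/-!
# Beta / RemainderExplicitCarrierGeometry — BINDER-OWNERS row D4, ROAD P3 (co-owner #3, unit `b2b-balaban-beta-d4-p3`), skeleton leaf E1
# (geometry half): fine sites over a localization domain, the one-block COLLAR, the torus sup-distance versus the remainder chain's
# periodic ℓ¹ site-to-cube distance `distCT`, and the two periodicities of the periodised test configuration `hTor`

HONEST FRAMING (page 1 of everything the β sub-cell writes): discharging `BetaPertH` makes Bałaban's UV stability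
UNCONDITIONAL — a real constructive-QFT result; it is NOT the continuum limit and NOT the Clay problem.  HONEST DEPENDENCY
(verbatim): «continuum YM on T⁴ ⇐ BetaPertH ∧ nine spine estimates (0/9 proved); BetaPertH ⇐ (D1) ∧ (D4) ∧ CAP+tail;
G-an2-4 gates asym, D1 and NE2/3/4.»  NOT IN PRINT; OUR BOOKKEEPING.  `[folklore]` lattice/torus geometry over an4's `B12Decay510Torus`
(`distCT`, `nearT`, `fibre`, `pl1`), pv17's `B4TorusKernel.MultiPeriod` (`torusSupNorm`, `circAbs`, `centre`) and gan24-leaf-18's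
`TorusPeriodise` / `TorusAvatar` (`Hper`, `pshift`, `Periodic`).  No cited fact, no wall binder, no `def … : Prop`.  NOT summit progress.

ABSOLUTE RULE (cell charter, verbatim): "No internally-minted statement may enter as a cited fact. Every hypothesis is
either kernel-proved in this package or a verbatim quotation of a PUBLISHED theorem with page reference. The manuscript(s)
under audit are NOT citable for their own disputed steps — they are the thing under adjudication; programme-internal
(2001/route/tribunal) claims are never citable."
-/

noncomputable section

open Finset Filter
open scoped BigOperators
open Literature.Probability.LatticeModels (TorusSite)
open Literature.MathematicalPhysics.QuantumFieldTheory.LatticeForm (quo)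
open Literature.MathematicalPhysics.QuantumFieldTheory.Balaban1983to89
open Literature.MathematicalPhysics.QuantumFieldTheory.Balaban1983to89.Beta
open Literature.MathematicalPhysics.QuantumFieldTheory.Balaban1983to89.TreeLengthTorus (TPt TDom proj natLift proj_natLift)
open Literature.MathematicalPhysics.QuantumFieldTheory.Balaban1983to89.B13ScaleTransfer (Pt)
open B12Sec2to5 (l1 l1_nonneg)
open B12Decay510Torus (pabs pl1 pl1_eq_sum pl1_proj_le_l1 pl1_sub_comm pl1_sub_triangle proj_sub tcubeOf distCT distCT_le
  exists_distCT_eq distCT_nonneg nearT nearT_le pabs_le_abs_of_cast_eq)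
open AffineAveraging (Site Form1 unitVec)
open B4ContourShift (supNorm)
open B4TorusKernel.MultiPeriod (torusSupNorm circAbs centre abs_add_mul_centre)
open BlochFibreUniqueness (quo_add_zsmul)
open Summit.QuantumFields.BalabanUV.Beta.GAN24.TorusPeriodise (pshift Hper pshift_add)
open Summit.QuantumFields.BalabanUV.Beta.RemainderExplicitUnits (side)
open Summit.QuantumFields.BalabanUV.Beta.RemainderExplicitTorusBounds (hTor)

namespace Summit.QuantumFields.BalabanUV.Beta.RemainderExplicitCarrierGeometry

/-! ## §1 Blocks of neighbouring fine points differ by at most one -/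

/-- [folklore] `a/N − 1 ≤ (a + e)/N ≤ a/N + 1` for `|e| ≤ 1 ≤ N`. -/
theorem abs_ediv_add_sub_ediv_le {N : ℕ} (hN : 0 < N) (a e : ℤ) (he : |e| ≤ 1) :
    |(a + e) / (N : ℤ) - a / (N : ℤ)| ≤ 1 := by
  have hN' : (0 : ℤ) < N := by exact_mod_cast hN
  have h1 : (1 : ℤ) ≤ N := by exact_mod_cast hN
  have hlo : a / (N : ℤ) - 1 ≤ (a + e) / (N : ℤ) := by
    have : (a - (N : ℤ)) / (N : ℤ) = a / (N : ℤ) - 1 := by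
      rw [show a - (N : ℤ) = a + (-1) * (N : ℤ) by ring, Int.add_mul_ediv_right _ _ hN'.ne']; ring
    rw [← this]
    exact Int.ediv_le_ediv hN' (by linarith [neg_abs_le e])
  have hhi : (a + e) / (N : ℤ) ≤ a / (N : ℤ) + 1 := by
    have : (a + (N : ℤ)) / (N : ℤ) = a / (N : ℤ) + 1 := by
      rw [show a + (N : ℤ) = a + 1 * (N : ℤ) by ring, Int.add_mul_ediv_right _ _ hN'.ne']
    rw [← this]
    exact Int.ediv_le_ediv hN' (by linarith [le_abs_self e])
  rw [abs_le]; constructor <;> linarith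

/-- [folklore] **BLOCKS OF NEIGHBOURS**: `|quo_N (z + e) − quo_N z|₁ ≤ d + 1` for a displacement with `|e_i| ≤ 1`. -/
theorem l1_quo_add_sub_quo_le {d N : ℕ} [NeZero N] (z e : Site (d + 1)) (he : ∀ i, |e i| ≤ 1) :
    l1 (quo N (z + e) - quo N z) ≤ (d + 1 : ℕ) := by
  unfold l1
  calc ∑ i, |(((quo N (z + e) - quo N z) i : ℤ) : ℝ)| ≤ ∑ _i : Fin (d + 1), (1 : ℝ) := by
        refine Finset.sum_le_sum fun i _ => ?_
        have h := abs_ediv_add_sub_ediv_le (Nat.pos_of_ne_zero (NeZero.ne N)) (z i) (e i) (he i)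
        have : (quo N (z + e) - quo N z) i = (z i + e i) / (N : ℤ) - z i / (N : ℤ) := by
          simp [quo, Pi.sub_apply, Pi.add_apply]
        rw [this]; exact_mod_cast h
    _ = (d + 1 : ℕ) := by simp

/-! ## §2 The torus sup-distance dominates the periodic ℓ¹ distance divided by the dimension -/

/-- [folklore] `pabs ((v : ZMod P)) ≤ circAbs P v` (the periodic distance of a residue is at most the circular distance of a lift). -/
theorem pabs_cast_le_circAbs {P : ℕ} [NeZero P] (v : ℤ) : (pabs ((v : ℤ) : ZMod P) : ℤ) ≤ circAbs P v := by
  have hP : 1 ≤ P := Nat.one_le_iff_ne_zero.2 (NeZero.ne P)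
  have hcast : (((v + (P : ℤ) * centre P v : ℤ)) : ZMod P) = ((v : ℤ) : ZMod P) := by
    push_cast; simp
  have h := pabs_le_abs_of_cast_eq hcast
  rw [abs_add_mul_centre hP v] at h
  exact h

/-- [folklore] **`pl1 (proj P v) ≤ (d+1)·torusSupNorm P v`**: the chain's periodic ℓ¹ distance is at most `d + 1` times pv17's torus
sup-distance (constant period vector). -/
theorem pl1_proj_le_mul_torusSupNorm {d P : ℕ} [NeZero P] (v : Pt (d + 1)) :
    pl1 (proj P v) ≤ (d + 1 : ℕ) * torusSupNorm (fun _ : Fin (d + 1) => P) v := by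
  rw [pl1_eq_sum]
  have hterm : ∀ i : Fin (d + 1), (pabs ((proj P v) i) : ℝ) ≤ torusSupNorm (fun _ : Fin (d + 1) => P) v := by
    intro i
    have h1 : (pabs ((proj P v) i) : ℤ) ≤ circAbs P (v i) := pabs_cast_le_circAbs (v i)
    have h2 : ((circAbs P (v i) : ℤ) : ℝ) ≤ torusSupNorm (fun _ : Fin (d + 1) => P) v :=
      Finset.le_sup' (fun k => ((circAbs ((fun _ : Fin (d + 1) => P) k) (v k) : ℤ) : ℝ)) (Finset.mem_univ i)
    exact le_trans (by exact_mod_cast h1) h2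
  calc ∑ i, (pabs ((proj P v) i) : ℝ) ≤ ∑ _i : Fin (d + 1), torusSupNorm (fun _ : Fin (d + 1) => P) v :=
        Finset.sum_le_sum fun i _ => hterm i
    _ = (d + 1 : ℕ) * torusSupNorm (fun _ : Fin (d + 1) => P) v := by simp

/-! ## §3 Fine sites over a domain, the one-block collar, and the two geometric facts the carrier needs -/

section Collar

variable {Nn Mc : ℕ} [NeZero Nn] [NeZero Mc] (Nb : ℕ) [NeZero Nb]

/-- The UNIT site (block) of a fine lattice point `w ∈ ℤ⁴` on the unit torus with `Nn·Mc` sites per direction: `[quo_{Nb} w]`. [folklore] -/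
def usite (w : Site 4) : TPt 4 (Nn * Mc) := proj (Nn * Mc) (quo Nb w)

/-- **THE ONE-BLOCK COLLAR** of a localization domain `X` (cubes of the unit torus): the unit sites at periodic ℓ¹ distance `≤ 4` from a
cube of `X` (contains every unit site within sup-distance `1` of `X̃`). [folklore] -/
def collar (X : TDom 4 Nn) : Finset (TPt 4 (Nn * Mc)) := by
  classical
  exact Finset.univ.filter fun u => ∃ c ∈ X.1, distCT Nn Mc u c ≤ 4

/-- Membership in the collar. [folklore] -/
theorem mem_collar {X : TDom 4 Nn} {u : TPt 4 (Nn * Mc)} : u ∈ collar (Mc := Mc) X ↔ ∃ c ∈ X.1, distCT Nn Mc u c ≤ 4 := by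
  classical
  simp [collar]

/-- [folklore] **STENCIL NEIGHBOURS OF A POINT OVER `X` LAND IN THE COLLAR**: if the cube of the block of `w` belongs to `X` and `|e_i| ≤ 1`,
then the block of `w + e` is in the collar of `X`. -/
theorem usite_add_mem_collar {X : TDom 4 Nn} {w : Site 4} (hw : tcubeOf Nn Mc (usite (Mc := Mc) Nb w) ∈ X.1) (e : Site 4)
    (he : ∀ i, |e i| ≤ 1) : usite (Mc := Mc) Nb (w + e) ∈ collar (Mc := Mc) X := by
  rw [mem_collar]
  refine ⟨tcubeOf Nn Mc (usite (Mc := Mc) Nb w), hw, ?_⟩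
  refine (distCT_le (q := usite (Mc := Mc) Nb w) rfl).trans ?_
  unfold usite
  rw [← proj_sub]
  refine (pl1_proj_le_l1 _).trans ?_
  have := l1_quo_add_sub_quo_le (N := Nb) w e he
  exact_mod_cast this

omit [NeZero Nb] in
/-- [folklore] **THE DISTANCE COMPARISON**: for a block `u` in the collar of `X`, any fine point `w` of that block and any unit source site `x`,
`distCT x (nearT x X) ≤ 4·torusSupNorm (quo_{Nb} w − natLift x) + 4` (nearest cube ≤ that cube ≤ triangle through `u` ≤ sup-distance bound). -/
theorem distCT_nearT_le {X : TDom 4 Nn} {w : Site 4} (hu : usite (Mc := Mc) Nb w ∈ collar (Mc := Mc) X) (x : TPt 4 (Nn * Mc)) :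
    distCT Nn Mc x (nearT (M := Mc) x X) ≤ 4 * torusSupNorm (fun _ : Fin 4 => Nn * Mc) (quo Nb w - natLift x) + 4 := by
  obtain ⟨c, hc, hd⟩ := (mem_collar (Mc := Mc)).1 hu
  obtain ⟨s, hs, hds⟩ := exists_distCT_eq (N := Nn) (M := Mc) (usite (Mc := Mc) Nb w) c
  have h1 : distCT Nn Mc x (nearT (M := Mc) x X) ≤ distCT Nn Mc x c := nearT_le x X hc
  have h2 : distCT Nn Mc x c ≤ pl1 (x - s) := distCT_le hs
  have h3 : pl1 (x - s) ≤ pl1 (x - usite (Mc := Mc) Nb w) + pl1 (usite (Mc := Mc) Nb w - s) := pl1_sub_triangle _ _ _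
  have h4 : pl1 (usite (Mc := Mc) Nb w - s) ≤ 4 := by rw [hds]; exact hd
  have h5 : pl1 (x - usite (Mc := Mc) Nb w) ≤ 4 * torusSupNorm (fun _ : Fin 4 => Nn * Mc) (quo Nb w - natLift x) := by
    rw [pl1_sub_comm]
    unfold usite
    conv_lhs => rw [← proj_natLift (N := Nn * Mc) x, ← proj_sub]
    have := pl1_proj_le_mul_torusSupNorm (d := 3) (P := Nn * Mc) (quo Nb w - natLift x)
    exact_mod_cast this
  linarith

end Collar

/-! ## §4 The two periodicities of the periodised test configuration -/

section Periodicity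

variable {Lc : ℕ} [NeZero Lc]

/-- [folklore] SOURCE PERIODICITY: `Hper N P μ (q + pshift P s) = Hper N P μ q` (re-indexing the period sum). -/
theorem Hper_add_pshift {N : ℕ} [NeZero N] (P : Fin 4 → ℕ) [∀ ν, NeZero (P ν)] (μ : Fin 4) (q s : Site 4) :
    Hper N P μ (q + pshift P s) = Hper N P μ q := by
  funext κ z
  simp only [Hper]
  rw [← (Equiv.addRight s).tsum_eq (fun t => ResolventComposition.Hcol (N := N) μ (q + pshift P s - pshift P t) κ z)]
  refine tsum_congr fun t => ?_
  simp only [Equiv.coe_addRight, pshift_add]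
  rw [show q + pshift P s - (pshift P t + pshift P s) = q - pshift P t by abel]

/-- [folklore] `hTor` depends on the source lift only through its class: `hTor j P μ (q + pshift P s) = hTor j P μ q`. -/
theorem hTor_add_pshift (j : ℕ) (P : Fin 4 → ℕ) [∀ ν, NeZero (P ν)] (μ : Fin 4) (q s : Site 4) :
    hTor Lc j P μ (q + pshift P s) = hTor Lc j P μ q := by
  unfold hTor
  rw [Hper_add_pshift]

/-- [folklore] FINE PERIODICITY: `hTor j P μ q κ (z + (N·P)•k) = hTor j P μ q κ z` (gan24-leaf-18's `periodic_Hper`). -/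
theorem hTor_add_periods (j : ℕ) (P : Fin 4 → ℕ) [∀ ν, NeZero (P ν)] (μ : Fin 4) (q : Site 4) (κ : Fin 4) (z k : Site 4) :
    hTor Lc j P μ q κ (z + fun ν => (((Lc ^ (j + 1)) * P ν : ℕ) : ℤ) * k ν) = hTor Lc j P μ q κ z := by
  haveI : NeZero (Lc ^ (j + 1)) := ⟨pow_ne_zero _ (NeZero.ne Lc)⟩
  have hper := Summit.QuantumFields.BalabanUV.Beta.GAN24.TorusPeriodise.periodic_Hper (Lc ^ (j + 1)) P μ q κ
  have h := GAN24.TorusAvatar.Periodic.add_periods hper z k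
  show side Lc j ^ 5 * Hper (Lc ^ (j + 1)) P μ q κ _ = side Lc j ^ 5 * Hper (Lc ^ (j + 1)) P μ q κ z
  rw [h]

/-- [folklore] The canonical lift of the class of `w` on the fine torus differs from `w` by a period vector. -/
theorem exists_natLift_proj_eq (Nf : ℕ) [NeZero Nf] (w : Site 4) :
    ∃ k : Site 4, natLift (proj Nf w) = w + fun ν => ((Nf : ℕ) : ℤ) * k ν := by
  have h : ∀ i, ∃ kk : ℤ, natLift (proj Nf w) i = w i + kk * Nf := by
    intro i
    have hc : ((w i : ℤ) : ZMod Nf) = ((natLift (proj Nf w) i : ℤ) : ZMod Nf) := by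
      have := congr_fun (proj_natLift (N := Nf) (proj Nf w)) i
      simp only [proj] at this
      exact this.symm
    exact B12Decay510Torus.exists_eq_add_mul_of_cast_eq hc
  choose k hk using h
  exact ⟨k, funext fun i => by rw [hk i, Pi.add_apply]; ring⟩

/-- [folklore] **`hTor` READ ON THE FINE TORUS**: `hTor κ (natLift (proj_{N·P} w)) = hTor κ w` (constant period vector `P`). -/
theorem hTor_natLift_proj (j P : ℕ) [NeZero P] (μ : Fin 4) (q : Site 4) (κ : Fin 4) (w : Site 4) :
    hTor Lc j (fun _ => P) μ q κ (natLift (proj (Lc ^ (j + 1) * P) w)) = hTor Lc j (fun _ => P) μ q κ w := by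
  haveI : NeZero (Lc ^ (j + 1) * P) := ⟨mul_ne_zero (pow_ne_zero _ (NeZero.ne Lc)) (NeZero.ne P)⟩
  obtain ⟨k, hk⟩ := exists_natLift_proj_eq (Lc ^ (j + 1) * P) w
  rw [hk]
  exact hTor_add_periods j (fun _ => P) μ q κ w k

end Periodicity

end Summit.QuantumFields.BalabanUV.Beta.RemainderExplicitCarrierGeometry

end
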